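import Summits.CriticalPhenomena.PercolationContinuityZ3.Theorems.PercNearOneGluingNoHeavyPcintNawFreeMemSym
import Summits.CriticalPhenomena.PercolationContinuityZ3.Theorems.PercNearOneGluingNoHeavyPcintNawChainMemKernelCert
import HarnessLib

/-!
# PCINT lane, reduction B2d on the dangerous-set automaton — kernel mirrors of the free-neighbour data

Cell `prim-pcint` (PAPER-2 track (iii)), seat `prim-pcint-1` (gen 6); support file (`--supports stmt-CriticalPhenomena-4575`).
Does NOT build on p205010.  Memo: run/shared/lean/prim/pcint/REDUCTIONS.md §B2d.

`decide +kernel`-evaluable mirrors on integer-list states (`NawK.KState` of `…PcintNawRandMemKernel`): the known list `fKK`,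
`fincK`, `isPosK`, `fcertK`, `ffreeK`, `fcntK`, `fprepayK`, `fselfK`, `fnpayK`, `funcondK`, `posAtK`, `fcornerK`, `fcondK`,
`fsitesK`, with bridges to the `Finset` data of `…PcintNawFreeMem` for well-formed lists with VALID AGES (`AOK`: ages `≥ 1` and
pairwise distinct, as along words): `toM_fKK`, `card_finc_eq`, `isPosK_iff`, `fcertK_eq`, `fcntK_eq`, `fprepayK_eq`, `fselfK_eq`,
`fnpayK_eq`, `funcondK_eq` (the corner/site bridges are in `…NawFreeMemKernelSites`).
-/

namespace Summit.CriticalPhenomena.PercolationContinuityZ3.Theorems.Pcint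

open Finset Literature.Probability.Percolation Literature.Probability.LatticeModels

namespace NawK

open WinK (toSite toL addL adjL toSite_addL toSite_toL adj_iff_adjL toSite_inj length_toL length_addL toSite_zeroL zeroL
  length_zeroL)

variable {d : ℕ}

/-! ### Kernel mirrors -/

/-- The kernel KNOWN LIST: `(0, 0)`, `(-e_a, 1)` and the shifted, aged entries. [folklore] -/
def fKK (d : ℕ) (L : KState) (a : Fin d × Bool) : KState :=
  (zeroL d, 0) :: (negL (toL d a), 1) :: L.map fun q => (subL q.1 (toL d a), q.2 + 1)

/-- VALID AGES (Boolean): all ages `≥ 1` and pairwise distinct. [folklore] -/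
def AOK (L : KState) : Bool := (L.all fun q => decide (1 ≤ q.2)) && decide ((L.map Prod.snd).Nodup)

/-- Kernel visible incidences of a site (entries of the known list adjacent to it). [folklore] -/
def fincK (d : ℕ) (K : KState) (w : List ℤ) : KState := K.filter fun q => adjL d q.1 w

/-- Kernel "is a known position". [folklore] -/
def isPosK (K : KState) (u : List ℤ) : Bool := K.any fun q => decide (q.1 = u)

/-- Kernel certification. [folklore] -/
def fcertK (τ d : ℕ) (K : KState) (u : List ℤ) : Bool :=
  K.any fun q => decide (1 ≤ q.2) && decide (q.2 + 1 + l1L u ≤ τ) && adjL d q.1 u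

/-- The `2d` lattice neighbours of a site, as integer lists. [folklore] -/
def nbrL (d : ℕ) (w : List ℤ) : List (List ℤ) := (letters d).map fun b => addL w (toL d b)

/-- Kernel list of free neighbours. [folklore] -/
def ffreeL (τ d : ℕ) (K : KState) (w : List ℤ) : List (List ℤ) :=
  (nbrL d w).filter fun u => !isPosK K u && !fcertK τ d K u

/-- Kernel count `#finc + #ffree`. [folklore] -/
def fcntK (τ d : ℕ) (K : KState) (w : List ℤ) : ℕ := (fincK d K w).length + (ffreeL τ d K w).length

/-- Kernel `fprepay`. [folklore] -/
def fprepayK (kt d : ℕ) (K : KState) (w : List ℤ) : Bool := (fincK d K w).any fun q => decide (q.2 + 2 = kt)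

/-- Kernel `fself`. [folklore] -/
def fselfK (τ kt d : ℕ) (K : KState) (w : List ℤ) : Bool :=
  decide (kt + 3 + l1L w ≤ τ) && ((fincK d K w).all fun q => !(q.2 == kt + 2)) && decide (2 ≤ (fincK d K w).length)

/-- Kernel `fnpay`. [folklore] -/
def fnpayK (τ kt d : ℕ) (K : KState) (w : List ℤ) : ℕ :=
  (if fprepayK kt d K w then 1 else 0) + (if fselfK τ kt d K w then 1 else 0)

/-- Kernel `funcond`. [folklore] -/
def funcondK (d : ℕ) (K : KState) (w : List ℤ) : Bool :=
  (fincK d K w).any fun q => (fincK d K w).any fun q' => decide (q.2 + 4 ≤ q'.2)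

/-- The position of the known entry of a given age, if any. [folklore] -/
def posAtK (K : KState) (A : ℕ) : Option (List ℤ) := (K.find? fun q => q.2 == A).map Prod.fst

/-- Kernel `fcorner`. [folklore] -/
def fcornerK (kt : ℕ) (K : KState) (w : List ℤ) : Bool :=
  match posAtK K kt, posAtK K (kt - 1), posAtK K (kt - 2) with
  | some P, some x₁, some x₂ => decide (w = subL (addL P x₂) x₁)
  | _, _, _ => false

/-- Kernel `fcond`. [folklore] -/
def fcondK (kt d : ℕ) (K : KState) (w : List ℤ) : Bool := !funcondK d K w && fcornerK kt K w

/-- Kernel list of inspected sites (neighbours of the pseudo-tip that are not known positions). [folklore] -/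
def fsitesK (kt d : ℕ) (K : KState) : List (List ℤ) :=
  match posAtK K kt with
  | none => []
  | some P => (nbrL d P).filter fun w => !isPosK K w

/-! ### Bridges -/

section Bridges

variable {L : KState} {a : Fin d × Bool}

/-- The known list is well formed. [folklore] -/
theorem WF_fKK (hL : WF d L = true) (a : Fin d × Bool) : WF d (fKK d L a) = true := by
  unfold WF fKK
  simp only [List.all_cons, List.all_map, Bool.and_eq_true, beq_iff_eq, length_zeroL, length_negL, length_toL, true_and,
    List.all_eq_true, Function.comp_apply]
  intro x hx
  exact length_subL (length_of_WF hL hx) (length_toL a)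

/-- The ages of the known list are pairwise distinct. [folklore] -/
theorem nodup_ages_fKK (hA : AOK L = true) (a : Fin d × Bool) : ((fKK d L a).map Prod.snd).Nodup := by
  unfold AOK at hA
  simp only [Bool.and_eq_true, List.all_eq_true, decide_eq_true_eq] at hA
  obtain ⟨h1, h2⟩ := hA
  unfold fKK
  simp only [List.map_cons, List.map_map, List.nodup_cons, List.mem_cons, List.mem_map, Function.comp_apply]
  refine ⟨?_, ?_, ?_⟩
  · rintro (h | ⟨x, -, hx⟩)
    · exact absurd h (by norm_num)
    · omega
  · rintro ⟨x, hx, hx1⟩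
    have := h1 x hx; omega
  · have : List.map (Prod.snd ∘ fun q : List ℤ × ℕ => (subL q.1 (toL d a), q.2 + 1)) L = (L.map Prod.snd).map (· + 1) := by
      rw [List.map_map]; rfl
    rw [this]
    exact h2.map (add_left_injective 1)

/-- **The known list denotes the known set.** [folklore] -/
theorem toM_fKK (hL : WF d L = true) (a : Fin d × Bool) : (toM (fKK d L a) : MState d) = fK (toM L) a := by
  ext q
  rw [mem_toM, mem_fK]
  unfold fKK
  simp only [List.mem_cons, List.mem_map]
  constructor
  · rintro ⟨x, hx, rfl⟩
    rcases hx with rfl | rfl | ⟨y, hy, rfl⟩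
    · left; simp [toSite_zeroL]
    · right; left
      simp only
      rw [toSite_negL (length_toL a), toSite_toL]
    · right; right
      refine ⟨((toSite y.1 : Site d), y.2), mem_toM.2 ⟨y, hy, rfl⟩, ?_⟩
      simp only
      rw [toSite_subL (length_of_WF hL hy) (length_toL a), toSite_toL]
  · rintro (rfl | rfl | ⟨r, hr, rfl⟩)
    · exact ⟨(zeroL d, 0), Or.inl rfl, by simp [toSite_zeroL]⟩
    · refine ⟨(negL (toL d a), 1), Or.inr (Or.inl rfl), ?_⟩
      simp only
      rw [toSite_negL (length_toL a), toSite_toL]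
    · obtain ⟨y, hy, rfl⟩ := mem_toM.1 hr
      refine ⟨(subL y.1 (toL d a), y.2 + 1), Or.inr (Or.inr ⟨y, hy, rfl⟩), ?_⟩
      simp only
      rw [toSite_subL (length_of_WF hL hy) (length_toL a), toSite_toL]

/-- Two entries of the known list with the same denotation are equal (distinct ages). [folklore] -/
theorem fKK_inj (hA : AOK L = true) {x y : List ℤ × ℕ} (hx : x ∈ fKK d L a) (hy : y ∈ fKK d L a)
    (h : ((toSite x.1 : Site d), x.2) = ((toSite y.1 : Site d), y.2)) : x = y := by
  have h2 : x.2 = y.2 := by have := congrArg Prod.snd h; simpa using this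
  exact List.inj_on_of_nodup_map (nodup_ages_fKK hA a) hx hy h2

/-- The denotation list of a sublist of the known list has no duplicates. [folklore] -/
theorem nodup_map_filter_fKK (hA : AOK L = true) (p : List ℤ × ℕ → Bool) :
    (((fKK d L a).filter p).map fun q => ((toSite q.1 : Site d), q.2)).Nodup := by
  refine List.Nodup.map_on (fun x hx y hy h => fKK_inj hA (List.mem_filter.1 hx).1 (List.mem_filter.1 hy).1 h) ?_
  exact (List.Nodup.of_map _ (nodup_ages_fKK hA a)).filter _

/-- Kernel visible incidences denote the visible incidences. [folklore] -/
theorem toM_fincK (hL : WF d L = true) {w : List ℤ} (hw : w.length = d) :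
    (toM (fincK d (fKK d L a) w) : MState d) = finc (toM L) a (toSite w) := by
  ext q
  rw [mem_toM, mem_finc, ← toM_fKK hL, mem_toM]
  unfold fincK
  constructor
  · rintro ⟨x, hx, rfl⟩
    obtain ⟨hxK, hadj⟩ := List.mem_filter.1 hx
    exact ⟨⟨x, hxK, rfl⟩, (adj_iff_adjL (length_of_WF (WF_fKK hL a) hxK) hw).2 hadj⟩
  · rintro ⟨⟨x, hxK, rfl⟩, hadj⟩
    exact ⟨x, List.mem_filter.2 ⟨hxK, (adj_iff_adjL (length_of_WF (WF_fKK hL a) hxK) hw).1 hadj⟩, rfl⟩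

/-- The number of kernel visible incidences is the number of visible incidences. [folklore] -/
theorem card_finc_eq (hL : WF d L = true) (hA : AOK L = true) {w : List ℤ} (hw : w.length = d) :
    (finc (toM L : MState d) a (toSite w)).card = (fincK d (fKK d L a) w).length := by
  rw [← toM_fincK hL hw, toM, List.card_toFinset]
  unfold fincK
  rw [(nodup_map_filter_fKK (a := a) hA fun q => adjL d q.1 w).dedup, List.length_map]

/-- Existential properties of the visible ages agree. [folklore] -/
theorem any_fincK_iff (hL : WF d L = true) {w : List ℤ} (hw : w.length = d) (P : ℕ → Prop) [DecidablePred P] :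
    ((fincK d (fKK d L a) w).any fun x => decide (P x.2)) = true ↔ ∃ q ∈ finc (toM L : MState d) a (toSite w), P q.2 := by
  rw [List.any_eq_true, ← toM_fincK hL hw]
  constructor
  · rintro ⟨x, hx, hP⟩; exact ⟨_, mem_toM.2 ⟨x, hx, rfl⟩, of_decide_eq_true hP⟩
  · rintro ⟨q, hq, hP⟩
    obtain ⟨x, hx, rfl⟩ := mem_toM.1 hq
    exact ⟨x, hx, decide_eq_true hP⟩

/-- Universal properties of the visible ages agree. [folklore] -/
theorem all_fincK_iff (hL : WF d L = true) {w : List ℤ} (hw : w.length = d) (P : ℕ → Prop) [DecidablePred P] :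
    ((fincK d (fKK d L a) w).all fun x => decide (P x.2)) = true ↔ ∀ q ∈ finc (toM L : MState d) a (toSite w), P q.2 := by
  rw [List.all_eq_true, ← toM_fincK hL hw]
  constructor
  · intro h q hq
    obtain ⟨x, hx, rfl⟩ := mem_toM.1 hq
    exact of_decide_eq_true (h x hx)
  · intro h x hx
    exact decide_eq_true (h _ (mem_toM.2 ⟨x, hx, rfl⟩))

/-- `isPosK` decides membership in the known positions. [folklore] -/
theorem isPosK_iff (hL : WF d L = true) {u : List ℤ} (hu : u.length = d) :
    isPosK (fKK d L a) u = true ↔ (toSite u : Site d) ∈ fpos (toM L) a := by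
  rw [isPosK, List.any_eq_true, mem_fpos, ← toM_fKK hL]
  constructor
  · rintro ⟨x, hx, hxu⟩
    have hxu := of_decide_eq_true hxu
    exact ⟨x.2, mem_toM.2 ⟨x, hx, by rw [hxu]⟩⟩
  · rintro ⟨A, hA⟩
    obtain ⟨x, hx, hxe⟩ := mem_toM.1 hA
    refine ⟨x, hx, decide_eq_true ?_⟩
    have h1 : (toSite x.1 : Site d) = toSite u := congrArg Prod.fst hxe
    exact toSite_inj (length_of_WF (WF_fKK hL a) hx) hu h1

/-- `fcertK` computes `fcert`. [folklore] -/
theorem fcertK_eq {τ : ℕ} (hL : WF d L = true) {u : List ℤ} (hu : u.length = d) :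
    fcertK τ d (fKK d L a) u = fcert τ (toM L : MState d) a (toSite u) := by
  rw [Bool.eq_iff_iff, fcertK, List.any_eq_true, fcert_iff, ← toM_fKK hL]
  constructor
  · rintro ⟨x, hx, h⟩
    simp only [Bool.and_eq_true, decide_eq_true_eq] at h
    obtain ⟨⟨h1, h2⟩, h3⟩ := h
    refine ⟨_, mem_toM.2 ⟨x, hx, rfl⟩, h1, by rw [l1_toSite hu]; exact h2, ?_⟩
    exact (adj_iff_adjL (length_of_WF (WF_fKK hL a) hx) hu).2 h3
  · rintro ⟨q, hq, h1, h2, h3⟩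
    obtain ⟨x, hx, rfl⟩ := mem_toM.1 hq
    refine ⟨x, hx, ?_⟩
    simp only [Bool.and_eq_true, decide_eq_true_eq]
    rw [l1_toSite hu] at h2
    exact ⟨⟨h1, h2⟩, (adj_iff_adjL (length_of_WF (WF_fKK hL a) hx) hu).1 h3⟩

/-- The neighbour list has length-`d` entries. [folklore] -/
theorem length_of_mem_nbrL {w u : List ℤ} (hw : w.length = d) (hu : u ∈ nbrL d w) : u.length = d := by
  obtain ⟨b, -, rfl⟩ := List.mem_map.1 hu
  exact length_addL hw (length_toL b)

/-- The neighbour list denotes the lattice neighbours, without repetition. [folklore] -/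
theorem nbrL_toFinset {w : List ℤ} (hw : w.length = d) :
    ((nbrL d w).map (toSite (d := d))).toFinset = nbrSites (toSite w) ∧ ((nbrL d w).map (toSite (d := d))).Nodup := by
  have hmap : (nbrL d w).map (toSite (d := d)) = (letters d).map fun b => toSite w + stepVec b := by
    rw [nbrL, List.map_map]
    refine List.map_congr_left fun b _ => ?_
    simp only [Function.comp_apply]
    rw [toSite_addL hw (length_toL b), toSite_toL]
  rw [hmap]
  constructor
  · ext y
    rw [List.mem_toFinset, List.mem_map, mem_nbrSites, zdGraph_adj_iff_stepVec]
    constructor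
    · rintro ⟨b, -, rfl⟩; exact ⟨b, rfl⟩
    · rintro ⟨b, rfl⟩; exact ⟨b, mem_letters b, rfl⟩
  · exact List.Nodup.map_on (fun b _ b' _ h => stepVec_injective (add_left_cancel h)) nodup_letters

/-- The kernel free-neighbour list denotes the free neighbours, without repetition. [folklore] -/
theorem ffreeL_toFinset {τ : ℕ} (hL : WF d L = true) {w : List ℤ} (hw : w.length = d) :
    ((ffreeL τ d (fKK d L a) w).map (toSite (d := d))).toFinset = ffree τ (toM L : MState d) a (toSite w) ∧
      ((ffreeL τ d (fKK d L a) w).map (toSite (d := d))).Nodup := by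
  obtain ⟨h1, h2⟩ := nbrL_toFinset (d := d) hw
  constructor
  · ext y
    rw [List.mem_toFinset, List.mem_map, mem_ffree, ← mem_nbrSites, ← h1, List.mem_toFinset, List.mem_map]
    constructor
    · rintro ⟨u, hu, rfl⟩
      obtain ⟨hun, hP⟩ := List.mem_filter.1 hu
      have hul := length_of_mem_nbrL hw hun
      simp only [Bool.and_eq_true, Bool.not_eq_true'] at hP
      refine ⟨⟨u, hun, rfl⟩, fun h => ?_, by rw [← fcertK_eq hL hul]; exact hP.2⟩
      rw [← isPosK_iff hL hul] at h; rw [hP.1] at h; exact Bool.noConfusion h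
    · rintro ⟨⟨u, hun, rfl⟩, hpos, hcert⟩
      have hul := length_of_mem_nbrL hw hun
      refine ⟨u, List.mem_filter.2 ⟨hun, ?_⟩, rfl⟩
      simp only [Bool.and_eq_true, Bool.not_eq_true']
      refine ⟨?_, by rw [fcertK_eq hL hul]; exact hcert⟩
      by_contra h
      rw [Bool.not_eq_false, isPosK_iff hL hul] at h
      exact hpos h
  · rw [ffreeL]
    exact h2.sublist (List.Sublist.map _ List.filter_sublist)

/-- `fcntK` computes `fcnt`. [folklore] -/
theorem fcntK_eq {τ : ℕ} (hL : WF d L = true) (hA : AOK L = true) {w : List ℤ} (hw : w.length = d) :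
    fcntK τ d (fKK d L a) w = fcnt τ (toM L : MState d) a (toSite w) := by
  obtain ⟨h1, h2⟩ := ffreeL_toFinset (τ := τ) (a := a) hL hw
  rw [fcntK, fcnt, card_finc_eq hL hA hw, ← h1, List.card_toFinset, h2.dedup, List.length_map]

/-- `fprepayK` computes `fprepay`. [folklore] -/
theorem fprepayK_eq {kt : ℕ} (hL : WF d L = true) {w : List ℤ} (hw : w.length = d) :
    fprepayK kt d (fKK d L a) w = fprepay kt (toM L : MState d) a (toSite w) := by
  rw [Bool.eq_iff_iff, fprepayK, any_fincK_iff hL hw (fun j => j + 2 = kt), fprepay_iff]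

/-- `fselfK` computes `fself`. [folklore] -/
theorem fselfK_eq {τ kt : ℕ} (hL : WF d L = true) (hA : AOK L = true) {w : List ℤ} (hw : w.length = d) :
    fselfK τ kt d (fKK d L a) w = fself τ kt (toM L : MState d) a (toSite w) := by
  rw [Bool.eq_iff_iff, fselfK, fself_iff, Bool.and_eq_true, Bool.and_eq_true, decide_eq_true_iff, decide_eq_true_iff,
    l1_toSite hw, ← card_finc_eq hL hA hw]
  have h : ((fincK d (fKK d L a) w).all fun q => !(q.2 == kt + 2)) = true ↔
      ∀ q ∈ finc (toM L : MState d) a (toSite w), q.2 ≠ kt + 2 := by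
    rw [← all_fincK_iff hL hw (fun j => j ≠ kt + 2)]
    simp only [List.all_eq_true, Bool.not_eq_true', beq_eq_false_iff_ne, ne_eq, decide_eq_true_eq]
  rw [h]; tauto

/-- `fnpayK` computes `fnpay`. [folklore] -/
theorem fnpayK_eq {τ kt : ℕ} (hL : WF d L = true) (hA : AOK L = true) {w : List ℤ} (hw : w.length = d) :
    fnpayK τ kt d (fKK d L a) w = fnpay τ kt (toM L : MState d) a (toSite w) := by
  rw [fnpayK, fnpay, fprepayK_eq hL hw, fselfK_eq hL hA hw]

/-- `funcondK` computes `funcond`. [folklore] -/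
theorem funcondK_eq (hL : WF d L = true) {w : List ℤ} (hw : w.length = d) :
    funcondK d (fKK d L a) w = funcond (toM L : MState d) a (toSite w) := by
  rw [Bool.eq_iff_iff, funcondK, List.any_eq_true, funcond_iff, ← toM_fincK hL hw]
  constructor
  · rintro ⟨x, hx, h⟩
    rw [List.any_eq_true] at h
    obtain ⟨y, hy, hxy⟩ := h
    exact ⟨_, mem_toM.2 ⟨x, hx, rfl⟩, _, mem_toM.2 ⟨y, hy, rfl⟩, of_decide_eq_true hxy⟩
  · rintro ⟨q, hq, q', hq', hqq⟩
    obtain ⟨x, hx, rfl⟩ := mem_toM.1 hq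
    obtain ⟨y, hy, rfl⟩ := mem_toM.1 hq'
    exact ⟨x, hx, List.any_eq_true.2 ⟨y, hy, decide_eq_true hqq⟩⟩

end Bridges

end NawK

end Summit.CriticalPhenomena.PercolationContinuityZ3.Theorems.Pcint
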